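import Mathlib
import Summits.CriticalPhenomena.Ising3DConformalLimit.Theses.HarmonicMomentsIsotropy
import Literature.Probability.LatticeModels.SusceptibilityMeanFieldBound
import Literature.Probability.LatticeModels.HighDimTrivialityUniformProofs
import Literature.Probability.LatticeModels.RegularScales
import HarnessLib

/-!
# Route HarmonicMomentsIsotropy — the hierarchy closure `AngularHierarchy → HarmonicDilution`

Item `stmt-CriticalPhenomena-6034` (`HarmonicDilution`, the subcritical harmonic dilution
milestone: every anisotropy ratio `a_{Y,m}(β) = k_{Y,m}(β) / M_{n+2m}(β)` of the free Ising
two-point function on `ℤ³` tends to `0` as `β ↑ β_c`) is, as filed, the open prediction of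
Campostrini–Pelissetto–Rossi–Vicari in its weakest form.  Inside the route it is the conclusion of
the glue item `HierarchyClosure` applied to the crux `AngularHierarchy`.  This file proves that
closure, i.e. the conditional milestone

* `harmonicDilution_of_angularHierarchy : AngularHierarchy → HarmonicDilution`,

whose statement is definitionally the route decl `HierarchyClosure`
(`hierarchyClosure_proof`).

## The argument (ODE comparison, integrated form)

Abstractly (`tendsto_div_zero_of_contraction`): let `k, M : ℝ → ℝ` with `M → +∞` along
`𝓝[<] β_c`, `|k/M| ≤ C` eventually, and the contraction of increments
`|k(β₂) - k(β₁)| ≤ (θ · sup_{[β₁,β₂]} |k/M| + ε) (M(β₂) - M(β₁))` for every `ε > 0` on a left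
neighbourhood of `β_c`, with `θ < 1`.  If eventually `|k/M| ≤ B` then, fixing `β₁` in that
region and letting `β₂ ↑ β_c` (so `M(β₂) → ∞`), one gets eventually
`|k/M| ≤ max θ 0 · B + 2ε` (`harmonicDilution_improve`); iterating from `B = C` gives
`limsup |k/M| ≤ 2ε / (1 - max θ 0)` for every `ε`, hence `k/M → 0`.  No monotonicity or continuity
of `k`, `M` in `β` is used.

Lattice inputs (all proved in the tree): exponential decay of `⟨σ₀σ_x⟩^∅_β` below `β_c`
(`twoPoint_exponentialDecay_of_lt_criticalBeta_holds`, giving summability of every moment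
`∑_x |x|^q ⟨σ₀σ_x⟩_β`, `summable_moment`), `χ(β) → ∞` as `β ↑ β_c`
(`tendsto_susceptibility_nhdsLT_criticalBeta`, giving `M_q(β) ≥ χ(β) - 1 → ∞` for `q ≥ 1`,
`tendsto_moment_atTop`), `0 ≤ ⟨σ₀σ_x⟩ ≤ 1` (GKS), and the elementary bound
`|Y(x)| ≤ (∑ |coeff Y|) |x|^n` for a homogeneous `Y` of degree `n`
(`abs_eval_le_of_isHomogeneous`), which gives the a-priori bound `|a_{Y,m}| ≤ ∑ |coeff Y|`
(`abs_ratio_le`).  The main theorem is a strong induction on the total degree `q = n + 2m`, feeding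
the induction hypothesis into the hypothesis of `AngularHierarchy` at level `q`.
-/

namespace Summit.CriticalPhenomena.Ising3DConformalLimit.Theorems

open Filter Topology Set
open scoped ENNReal
open Literature.Probability.LatticeModels
open Summit.CriticalPhenomena.Ising3DConformalLimit.Theses.HarmonicMomentsIsotropy

/-! ### The abstract contraction lemma -/

/-- One improvement step of the a-priori bound: if eventually `|k/M| ≤ B` then, for every
`ε > 0`, eventually `|k/M| ≤ max θ 0 * B + 2 ε`. -/
theorem harmonicDilution_improve {k M : ℝ → ℝ} {βc θ B ε : ℝ}
    (hM : Tendsto M (𝓝[<] βc) atTop)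
    (hB0 : 0 ≤ B)
    (hB : ∀ᶠ β in 𝓝[<] βc, |k β / M β| ≤ B)
    (hε : 0 < ε)
    (h : ∃ β₀ : ℝ, β₀ < βc ∧ ∀ β₁ β₂ : ℝ, β₀ ≤ β₁ → β₁ < β₂ → β₂ < βc →
      |k β₂ - k β₁| ≤ (θ * sSup ((fun β => |k β / M β|) '' Set.Icc β₁ β₂) + ε) * (M β₂ - M β₁)) :
    ∀ᶠ β in 𝓝[<] βc, |k β / M β| ≤ max θ 0 * B + 2 * ε := by
  obtain ⟨β₀, hβ₀, hincr⟩ := h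
  obtain ⟨l, hl, hsub⟩ := mem_nhdsLT_iff_exists_Ioo_subset.1 hB
  set β₁ : ℝ := (max β₀ l + βc) / 2 with hβ₁_def
  have hmax : max β₀ l < βc := max_lt hβ₀ hl
  have hβ₀₁ : β₀ ≤ β₁ := by
    have := le_max_left β₀ l
    rw [hβ₁_def]; linarith
  have hl₁ : l < β₁ := by
    have := le_max_right β₀ l
    rw [hβ₁_def]; linarith
  have hβ₁c : β₁ < βc := by rw [hβ₁_def]; linarith
  set θ' : ℝ := max θ 0 with hθ'
  have hθ'0 : 0 ≤ θ' := le_max_right _ _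
  set K : ℝ := |k β₁| + (θ' * B + ε) * |M β₁| with hK
  have hK0 : 0 ≤ K := by positivity
  filter_upwards [Ioo_mem_nhdsLT hβ₁c, hM.eventually_ge_atTop (K / ε),
    hM.eventually_ge_atTop (M β₁), hM.eventually_ge_atTop 1] with β₂ hβ₂ hMK hM₁₂ hM1
  have hMpos : 0 < M β₂ := lt_of_lt_of_le one_pos hM1
  -- the supremum of `|a|` over `[β₁, β₂]` is at most `B` and nonnegative
  have hSle : sSup ((fun β => |k β / M β|) '' Set.Icc β₁ β₂) ≤ B := by
    refine csSup_le ((Set.nonempty_Icc.2 hβ₂.1.le).image _) ?_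
    rintro _ ⟨β, hβ, rfl⟩
    exact hsub ⟨hl₁.trans_le hβ.1, hβ.2.trans_lt hβ₂.2⟩
  have hS0 : 0 ≤ sSup ((fun β => |k β / M β|) '' Set.Icc β₁ β₂) :=
    Real.sSup_nonneg (by rintro _ ⟨β, _, rfl⟩; exact abs_nonneg _)
  have hθS : θ * sSup ((fun β => |k β / M β|) '' Set.Icc β₁ β₂) ≤ θ' * B :=
    (mul_le_mul_of_nonneg_right (le_max_left θ 0) hS0).trans
      (mul_le_mul_of_nonneg_left hSle hθ'0)
  have hΔM : 0 ≤ M β₂ - M β₁ := by linarith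
  have hk := hincr β₁ β₂ hβ₀₁ hβ₂.1 hβ₂.2
  have hk' : |k β₂ - k β₁| ≤ (θ' * B + ε) * (M β₂ - M β₁) :=
    hk.trans (mul_le_mul_of_nonneg_right (by linarith) hΔM)
  have hk₂ : |k β₂| ≤ K + (θ' * B + ε) * M β₂ := by
    have h1 : |k β₂| ≤ |k β₁| + |k β₂ - k β₁| := by
      have := abs_add_le (k β₁) (k β₂ - k β₁)
      simpa [add_sub_cancel] using this
    have h2 : -((θ' * B + ε) * M β₁) ≤ (θ' * B + ε) * |M β₁| := by
      have h3 : -M β₁ ≤ |M β₁| := neg_le_abs _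
      have h4 : 0 ≤ θ' * B + ε := by positivity
      nlinarith
    rw [hK]
    nlinarith
  have hKM : K ≤ ε * M β₂ := by
    have := (div_le_iff₀ hε).1 hMK
    linarith
  rw [abs_div, abs_of_pos hMpos, div_le_iff₀ hMpos]
  nlinarith

/-- The abstract ODE-comparison lemma: contraction of increments forces `k/M → 0`. -/
theorem tendsto_div_zero_of_contraction {k M : ℝ → ℝ} {βc C θ : ℝ}
    (hM : Tendsto M (𝓝[<] βc) atTop)
    (hC : ∀ᶠ β in 𝓝[<] βc, |k β / M β| ≤ C)
    (hθ : θ < 1)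
    (h : ∀ ε : ℝ, 0 < ε → ∃ β₀ : ℝ, β₀ < βc ∧ ∀ β₁ β₂ : ℝ, β₀ ≤ β₁ → β₁ < β₂ → β₂ < βc →
      |k β₂ - k β₁| ≤ (θ * sSup ((fun β => |k β / M β|) '' Set.Icc β₁ β₂) + ε) * (M β₂ - M β₁)) :
    Tendsto (fun β => k β / M β) (𝓝[<] βc) (𝓝 0) := by
  set θ' : ℝ := max θ 0 with hθ'
  have hθ'0 : 0 ≤ θ' := le_max_right _ _
  have hθ'1 : θ' < 1 := max_lt hθ one_pos
  set C₀ : ℝ := max C 0 with hC₀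
  have hC₀0 : 0 ≤ C₀ := le_max_right _ _
  have hC' : ∀ᶠ β in 𝓝[<] βc, |k β / M β| ≤ C₀ := hC.mono fun β hβ => hβ.trans (le_max_left _ _)
  -- iterate the improvement step
  have iter : ∀ ε : ℝ, 0 < ε → ∀ j : ℕ,
      ∀ᶠ β in 𝓝[<] βc, |k β / M β| ≤ θ' ^ j * C₀ + 2 * ε / (1 - θ') := by
    intro ε hε j
    have hε' : 0 ≤ 2 * ε / (1 - θ') := div_nonneg (by linarith) (by linarith)
    induction j with
    | zero =>
      exact hC'.mono fun β hβ => by rw [pow_zero, one_mul]; linarith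
    | succ j ih =>
      have hB0 : 0 ≤ θ' ^ j * C₀ + 2 * ε / (1 - θ') := by positivity
      have step := harmonicDilution_improve (θ := θ) hM hB0 ih hε (h ε hε)
      refine step.mono fun β hβ => ?_
      have hid : θ' * (θ' ^ j * C₀ + 2 * ε / (1 - θ')) + 2 * ε
          = θ' ^ (j + 1) * C₀ + 2 * ε / (1 - θ') := by
        have h1 : (1 - θ') ≠ 0 := by linarith
        field_simp
        ring
      rw [← hid]
      exact hβ
  rw [Metric.tendsto_nhds]
  intro δ hδ
  -- choose ε with 2ε/(1-θ') = δ/4 and j with θ'^j C₀ < δ/4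
  set ε : ℝ := δ * (1 - θ') / 8 with hε_def
  have hε : 0 < ε := by rw [hε_def]; nlinarith
  have hεδ : 2 * ε / (1 - θ') = δ / 4 := by
    have h1 : (1 - θ') ≠ 0 := by linarith
    rw [hε_def]; field_simp; ring
  obtain ⟨j, hj⟩ : ∃ j : ℕ, θ' ^ j < δ / (4 * (C₀ + 1)) :=
    exists_pow_lt_of_lt_one (by positivity) hθ'1
  have hjC : θ' ^ j * C₀ < δ / 4 := by
    have h1 : θ' ^ j * C₀ ≤ θ' ^ j * (C₀ + 1) :=
      mul_le_mul_of_nonneg_left (by linarith) (pow_nonneg hθ'0 j)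
    have h2 : θ' ^ j * (C₀ + 1) < δ / (4 * (C₀ + 1)) * (C₀ + 1) :=
      mul_lt_mul_of_pos_right hj (by linarith)
    have h3 : δ / (4 * (C₀ + 1)) * (C₀ + 1) = δ / 4 := by
      field_simp
    linarith
  filter_upwards [iter ε hε j] with β hβ
  rw [Real.dist_eq, sub_zero]
  rw [hεδ] at hβ
  linarith

/-! ### Lattice-side inputs -/

/-- A homogeneous polynomial of degree `n` is bounded by `(∑ |coeff|) r ^ n` on the sup-ball of
radius `r`. -/
theorem abs_eval_le_of_isHomogeneous {σ : Type*} (Y : MvPolynomial σ ℝ) {n : ℕ}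
    (hY : Y.IsHomogeneous n) (v : σ → ℝ) {r : ℝ} (hv : ∀ i, |v i| ≤ r) :
    |MvPolynomial.eval v Y| ≤ (∑ d ∈ Y.support, |Y.coeff d|) * r ^ n := by
  rw [MvPolynomial.eval_eq, Finset.sum_mul]
  refine (Finset.abs_sum_le_sum_abs _ _).trans (Finset.sum_le_sum fun d hd => ?_)
  rw [abs_mul]
  refine mul_le_mul_of_nonneg_left ?_ (abs_nonneg _)
  rw [Finset.abs_prod]
  calc ∏ i ∈ d.support, |v i ^ d i| = ∏ i ∈ d.support, |v i| ^ d i := by simp_rw [abs_pow]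
    _ ≤ ∏ i ∈ d.support, r ^ d i := Finset.prod_le_prod (fun i _ => by positivity)
        (fun i _ => pow_le_pow_left₀ (abs_nonneg _) (hv i) _)
    _ = r ^ ∑ i ∈ d.support, d i := Finset.prod_pow_eq_pow_sum _ _ _
    _ = r ^ n := by rw [← hY.degree_eq_sum_deg_support hd]

/-- Each coordinate is bounded by the Euclidean norm. -/
theorem abs_coord_le_euclid (x : Site 3) (i : Fin 3) :
    |((x i : ℤ) : ℝ)| ≤ Real.sqrt (∑ j, ((x j : ℤ) : ℝ) ^ 2) :=
  Real.abs_le_sqrt (Finset.single_le_sum (f := fun j => ((x j : ℤ) : ℝ) ^ 2)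
    (fun _ _ => sq_nonneg _) (Finset.mem_univ i))

/-- A nonzero lattice point has Euclidean norm at least `1`. -/
theorem one_le_euclid_of_ne_zero {x : Site 3} (hx : x ≠ 0) :
    1 ≤ Real.sqrt (∑ j, ((x j : ℤ) : ℝ) ^ 2) := by
  obtain ⟨i, hi⟩ := Function.ne_iff.1 hx
  rw [Real.one_le_sqrt]
  have h1 : (1 : ℝ) ≤ ((x i : ℤ) : ℝ) ^ 2 := by
    have h2 : (1 : ℤ) ≤ |x i| := Int.one_le_abs hi
    have h3 : (1 : ℝ) ≤ |((x i : ℤ) : ℝ)| := by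
      rw [← Int.cast_abs]; exact_mod_cast h2
    nlinarith [abs_nonneg ((x i : ℤ) : ℝ), sq_abs ((x i : ℤ) : ℝ)]
  exact h1.trans (Finset.single_le_sum (f := fun j => ((x j : ℤ) : ℝ) ^ 2)
    (fun _ _ => sq_nonneg _) (Finset.mem_univ i))

/-- The Euclidean norm is at most twice the sup norm on `ℤ³`. -/
theorem euclid_le_two_mul_norm (x : Site 3) :
    Real.sqrt (∑ j, ((x j : ℤ) : ℝ) ^ 2) ≤ 2 * ‖x‖ := by
  have hcoord : ∀ j, ((x j : ℤ) : ℝ) ^ 2 ≤ ‖x‖ ^ 2 := fun j => by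
    have h1 : |((x j : ℤ) : ℝ)| ≤ ‖x‖ := by rw [← Int.norm_eq_abs]; exact norm_le_pi_norm x j
    have h2 : 0 ≤ |((x j : ℤ) : ℝ)| := abs_nonneg _
    calc ((x j : ℤ) : ℝ) ^ 2 = |((x j : ℤ) : ℝ)| ^ 2 := (sq_abs _).symm
      _ ≤ ‖x‖ ^ 2 := pow_le_pow_left₀ h2 h1 2
  have hsum : ∑ j, ((x j : ℤ) : ℝ) ^ 2 ≤ (2 * ‖x‖) ^ 2 := by
    calc ∑ j, ((x j : ℤ) : ℝ) ^ 2 ≤ ∑ _j : Fin 3, ‖x‖ ^ 2 := Finset.sum_le_sum fun j _ => hcoord j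
      _ = 3 * ‖x‖ ^ 2 := by simp
      _ ≤ (2 * ‖x‖) ^ 2 := by nlinarith [norm_nonneg x]
  calc Real.sqrt (∑ j, ((x j : ℤ) : ℝ) ^ 2) ≤ Real.sqrt ((2 * ‖x‖) ^ 2) := Real.sqrt_le_sqrt hsum
    _ = 2 * ‖x‖ := Real.sqrt_sq (by positivity)

/-- Below `β_c` all polynomial moments of the free two-point function are summable
(exponential decay, Aizenman–Barsky–Fernández). -/
theorem summable_moment {β : ℝ} (hβ : 0 ≤ β) (hβc : β < criticalBeta 3) (q : ℕ) :
    Summable fun x : Site 3 => Real.sqrt (∑ j, ((x j : ℤ) : ℝ) ^ 2) ^ q * twoPointFree 3 β x := by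
  obtain ⟨c, hc, hdec⟩ :=
    twoPoint_exponentialDecay_of_lt_criticalBeta_holds (d := 3) (by norm_num) hβ hβc
  have hG0 : ∀ x, 0 ≤ twoPointFree 3 β x := fun x => twoPointFree_nonneg_of_nonneg (d := 3) hβ x
  set C : ℝ := 2 ^ q * ((q.factorial : ℝ) * (2 / c) ^ q) with hC
  refine summable_of_exp_decay (fun x => mul_nonneg (pow_nonneg (Real.sqrt_nonneg _) _) (hG0 x))
    (C := C) (c := c / 2) (half_pos hc) fun x => ?_
  have ht : 0 ≤ ‖x‖ := norm_nonneg x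
  have hpow : ‖x‖ ^ q ≤ (q.factorial : ℝ) * (2 / c) ^ q * Real.exp (c / 2 * ‖x‖) := by
    have h1 := Real.pow_div_factorial_le_exp (x := c / 2 * ‖x‖) (by positivity) q
    have hfac : (0 : ℝ) < q.factorial := by exact_mod_cast q.factorial_pos
    rw [div_le_iff₀ hfac, mul_pow] at h1
    have hid : (2 / c) ^ q * (c / 2) ^ q = 1 := by
      rw [← mul_pow]
      have : (2 / c) * (c / 2) = 1 := by field_simp
      rw [this, one_pow]
    calc ‖x‖ ^ q = (2 / c) ^ q * ((c / 2) ^ q * ‖x‖ ^ q) := by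
          rw [← mul_assoc, hid, one_mul]
      _ ≤ (2 / c) ^ q * (Real.exp (c / 2 * ‖x‖) * q.factorial) :=
          mul_le_mul_of_nonneg_left h1 (by positivity)
      _ = (q.factorial : ℝ) * (2 / c) ^ q * Real.exp (c / 2 * ‖x‖) := by ring
  have hexp : Real.exp (c / 2 * ‖x‖) * Real.exp (-c * ‖x‖) = Real.exp (-(c / 2) * ‖x‖) := by
    rw [← Real.exp_add]; ring_nf
  calc Real.sqrt (∑ j, ((x j : ℤ) : ℝ) ^ 2) ^ q * twoPointFree 3 β x
      ≤ (2 * ‖x‖) ^ q * Real.exp (-c * ‖x‖) :=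
        mul_le_mul (pow_le_pow_left₀ (Real.sqrt_nonneg _) (euclid_le_two_mul_norm x) q) (hdec x)
          (hG0 x) (by positivity)
    _ = 2 ^ q * ‖x‖ ^ q * Real.exp (-c * ‖x‖) := by rw [mul_pow]
    _ ≤ 2 ^ q * ((q.factorial : ℝ) * (2 / c) ^ q * Real.exp (c / 2 * ‖x‖)) * Real.exp (-c * ‖x‖) :=
        mul_le_mul_of_nonneg_right (mul_le_mul_of_nonneg_left hpow (by positivity)) (by positivity)
    _ = 2 ^ q * ((q.factorial : ℝ) * (2 / c) ^ q) * (Real.exp (c / 2 * ‖x‖) * Real.exp (-c * ‖x‖)) := by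
        ring
    _ = C * Real.exp (-(c / 2) * ‖x‖) := by rw [hexp]

/-- The isotropic moments `M_q(β) = ∑_x |x|^q ⟨σ₀σ_x⟩_β`, `q ≥ 1`, diverge as `β ↑ β_c`
(they dominate `χ(β) - 1`). -/
theorem tendsto_moment_atTop {q : ℕ} (hq : 1 ≤ q) :
    Tendsto (fun β => ∑' x : Site 3, Real.sqrt (∑ j, ((x j : ℤ) : ℝ) ^ 2) ^ q * twoPointFree 3 β x)
      (𝓝[<] criticalBeta 3) atTop := by
  have _hq := hq
  have hd : 2 ≤ 3 := by norm_num
  have hχ := tendsto_susceptibility_nhdsLT_criticalBeta (d := 3) hd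
  have hβc : 0 < criticalBeta 3 := criticalBeta_pos_holds hd
  rw [tendsto_atTop]
  intro R
  obtain ⟨N, hN⟩ := exists_nat_ge (R + 1)
  have hχN : ∀ᶠ β in 𝓝[<] criticalBeta 3, (N : ℝ≥0∞) < susceptibility 3 β :=
    ENNReal.tendsto_nhds_top_iff_nat.1 hχ N
  filter_upwards [Ioo_mem_nhdsLT hβc, hχN] with β hβ hχβ
  have hβ0 : 0 ≤ β := hβ.1.le
  set g : Site 3 → ℝ := fun x => Real.sqrt (∑ j, ((x j : ℤ) : ℝ) ^ 2) ^ q * twoPointFree 3 β x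
    with hg
  have hG0 : ∀ x, 0 ≤ twoPointFree 3 β x := fun x => twoPointFree_nonneg_of_nonneg (d := 3) hβ0 x
  have hG1 : ∀ x, twoPointFree 3 β x ≤ 1 := fun x =>
    twoPointFree_le_one hasBoxLimit_isingCorr_free_holds hβ0 x
  have hg0 : ∀ x, 0 ≤ g x := fun x => mul_nonneg (pow_nonneg (Real.sqrt_nonneg _) _) (hG0 x)
  have hsum : Summable g := summable_moment hβ0 hβ.2 q
  have hχ' : (N : ℝ≥0∞) < ⨆ s : Finset (Site 3), ∑ x ∈ s, ENNReal.ofReal (twoPointFree 3 β x) := by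
    have h := hχβ
    unfold susceptibility at h
    rwa [ENNReal.tsum_eq_iSup_sum] at h
  obtain ⟨s, hs⟩ := lt_iSup_iff.1 hχ'
  rw [← ENNReal.ofReal_sum_of_nonneg (fun x _ => hG0 x), ← ENNReal.ofReal_natCast,
    ENNReal.ofReal_lt_ofReal_iff'] at hs
  have hterm : ∀ x, twoPointFree 3 β x ≤ g x + (if x = 0 then 1 else 0) := by
    intro x
    by_cases hx : x = 0
    · rw [if_pos hx]; linarith [hG1 x, hg0 x]
    · rw [if_neg hx, add_zero]
      exact le_mul_of_one_le_left (hG0 x) (one_le_pow₀ (one_le_euclid_of_ne_zero hx))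
  have hfin : ∑ x ∈ s, twoPointFree 3 β x ≤ ∑' x, g x + 1 := by
    calc ∑ x ∈ s, twoPointFree 3 β x ≤ ∑ x ∈ s, (g x + (if x = 0 then 1 else 0)) :=
          Finset.sum_le_sum fun x _ => hterm x
      _ = ∑ x ∈ s, g x + ∑ x ∈ s, (if x = 0 then (1 : ℝ) else 0) := Finset.sum_add_distrib
      _ ≤ ∑' x, g x + 1 := by
          have h1 : ∑ x ∈ s, g x ≤ ∑' x, g x := hsum.sum_le_tsum s (fun x _ => hg0 x)
          have h2 : ∑ x ∈ s, (if x = 0 then (1 : ℝ) else 0) ≤ 1 := by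
            rw [Finset.sum_ite_eq']; split_ifs <;> norm_num
          linarith
  have hNR : R + 1 ≤ (N : ℝ) := hN
  show R ≤ ∑' x, g x
  linarith [hs.1]

/-- The a-priori bound `|a_{Y,m}(β)| ≤ ∑ |coeff Y|` for `0 ≤ β < β_c`. -/
theorem abs_ratio_le {β : ℝ} (hβ : 0 ≤ β) (hβc : β < criticalBeta 3)
    (Y : MvPolynomial (Fin 3) ℝ) {n : ℕ} (hY : Y.IsHomogeneous n) (m : ℕ) :
    |(∑' x : Site 3, MvPolynomial.eval (fun i => ((x i : ℤ) : ℝ)) Y *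
        Real.sqrt (∑ j, ((x j : ℤ) : ℝ) ^ 2) ^ (2 * m) * twoPointFree 3 β x) /
      (∑' x : Site 3, Real.sqrt (∑ j, ((x j : ℤ) : ℝ) ^ 2) ^ (n + 2 * m) * twoPointFree 3 β x)|
      ≤ ∑ d ∈ Y.support, |Y.coeff d| := by
  set CY : ℝ := ∑ d ∈ Y.support, |Y.coeff d| with hCY
  have hCY0 : 0 ≤ CY := Finset.sum_nonneg fun d _ => abs_nonneg _
  set nE : Site 3 → ℝ := fun x => Real.sqrt (∑ j, ((x j : ℤ) : ℝ) ^ 2) with hnE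
  have hnE0 : ∀ x, 0 ≤ nE x := fun x => Real.sqrt_nonneg _
  have hG0 : ∀ x, 0 ≤ twoPointFree 3 β x := fun x => twoPointFree_nonneg_of_nonneg (d := 3) hβ x
  set f : Site 3 → ℝ := fun x => MvPolynomial.eval (fun i => ((x i : ℤ) : ℝ)) Y *
    nE x ^ (2 * m) * twoPointFree 3 β x with hf
  set g : Site 3 → ℝ := fun x => nE x ^ (n + 2 * m) * twoPointFree 3 β x with hg
  have hg0 : ∀ x, 0 ≤ g x := fun x => mul_nonneg (pow_nonneg (hnE0 x) _) (hG0 x)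
  have hfg : ∀ x, |f x| ≤ CY * g x := by
    intro x
    have hev : |MvPolynomial.eval (fun i => ((x i : ℤ) : ℝ)) Y| ≤ CY * nE x ^ n :=
      abs_eval_le_of_isHomogeneous Y hY _ (fun i => abs_coord_le_euclid x i)
    have h1 : 0 ≤ nE x ^ (2 * m) * twoPointFree 3 β x := mul_nonneg (pow_nonneg (hnE0 x) _) (hG0 x)
    simp only [hf, hg]
    rw [abs_mul, abs_mul, abs_of_nonneg (hG0 x), abs_of_nonneg (pow_nonneg (hnE0 x) _)]
    calc |MvPolynomial.eval (fun i => ((x i : ℤ) : ℝ)) Y| * nE x ^ (2 * m) * twoPointFree 3 β x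
        = |MvPolynomial.eval (fun i => ((x i : ℤ) : ℝ)) Y| * (nE x ^ (2 * m) * twoPointFree 3 β x) := by
          ring
      _ ≤ CY * nE x ^ n * (nE x ^ (2 * m) * twoPointFree 3 β x) :=
          mul_le_mul_of_nonneg_right hev h1
      _ = CY * (nE x ^ (n + 2 * m) * twoPointFree 3 β x) := by rw [pow_add]; ring
  have hgs : Summable g := summable_moment hβ hβc (n + 2 * m)
  have hfs : Summable f :=
    (hgs.mul_left CY).of_norm_bounded (fun x => by rw [Real.norm_eq_abs]; exact hfg x)
  have hk : |∑' x, f x| ≤ CY * ∑' x, g x := by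
    calc |∑' x, f x| ≤ ∑' x, |f x| := by
          have := norm_tsum_le_tsum_norm hfs.norm
          simpa only [Real.norm_eq_abs] using this
      _ ≤ ∑' x, CY * g x := hfs.abs.tsum_le_tsum hfg (hgs.mul_left CY)
      _ = CY * ∑' x, g x := tsum_mul_left
  show |(∑' x, f x) / (∑' x, g x)| ≤ CY
  rcases (tsum_nonneg hg0).eq_or_lt with h0 | hpos
  · rw [← h0, div_zero, abs_zero]; exact hCY0
  · rw [abs_div, abs_of_pos hpos, div_le_iff₀ hpos]; exact hk

/-! ### The closure -/

/-- **Hierarchy closure** (the content of route item `HierarchyClosure`, stmt-6035, and the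
in-route proof of the milestone `HarmonicDilution`, stmt-6034, from the crux `AngularHierarchy`,
stmt-6031): if, inductively in the total degree `q = n + 2m`, the `β`-increments of every harmonic
moment `k_{Y,m}` are contracted (factor `θ < 1`) relative to those of the isotropic moment
`M_{n+2m}`, then every anisotropy ratio `a_{Y,m}(β) → 0` as `β ↑ β_c(3)`. -/
theorem harmonicDilution_of_angularHierarchy (hAH : AngularHierarchy) : HarmonicDilution := by
  dsimp only [AngularHierarchy] at hAH
  dsimp only [HarmonicDilution]
  suffices H : ∀ (q n m : ℕ) (Y : MvPolynomial (Fin 3) ℝ), n + 2 * m = q → 1 ≤ n →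
      Y.IsHomogeneous n → (∑ i : Fin 3, MvPolynomial.pderiv i (MvPolynomial.pderiv i Y)) = 0 →
      Tendsto (fun β => (∑' x : Site 3, MvPolynomial.eval (fun i => ((x i : ℤ) : ℝ)) Y *
          Real.sqrt (∑ i, ((x i : ℤ) : ℝ) ^ 2) ^ (2 * m) * twoPointFree 3 β x) /
        (∑' x : Site 3, Real.sqrt (∑ i, ((x i : ℤ) : ℝ) ^ 2) ^ (n + 2 * m) * twoPointFree 3 β x))
        (𝓝[<] criticalBeta 3) (𝓝 0) by
    intro n m Y hn hY hΔ
    exact H _ n m Y rfl hn hY hΔ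
  intro q
  induction q using Nat.strong_induction_on with
  | _ q ih =>
    intro n m Y hq hn hY hΔ
    obtain ⟨θ, hθ, hcontr⟩ := hAH q
      (fun n' m' Y' hn' hlt hY' hΔ' => ih _ hlt n' m' Y' rfl hn' hY' hΔ') n m Y hn hq hY hΔ
    have hβc : 0 < criticalBeta 3 := criticalBeta_pos_holds (by norm_num)
    refine tendsto_div_zero_of_contraction
      (k := fun β => ∑' x : Site 3, MvPolynomial.eval (fun i => ((x i : ℤ) : ℝ)) Y *
          Real.sqrt (∑ i, ((x i : ℤ) : ℝ) ^ 2) ^ (2 * m) * twoPointFree 3 β x)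
      (M := fun β => ∑' x : Site 3,
          Real.sqrt (∑ i, ((x i : ℤ) : ℝ) ^ 2) ^ (n + 2 * m) * twoPointFree 3 β x)
      (C := ∑ d ∈ Y.support, |Y.coeff d|)
      (tendsto_moment_atTop (q := n + 2 * m) (by omega)) ?_ hθ hcontr
    filter_upwards [Ioo_mem_nhdsLT hβc] with β hβ
    exact abs_ratio_le hβ.1.le hβ.2 Y hY m

/-- The route decl `HierarchyClosure` (item stmt-CriticalPhenomena-6035) is literally
`AngularHierarchy → HarmonicDilution`; this is its proof. -/
theorem hierarchyClosure_proof : HierarchyClosure :=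
  harmonicDilution_of_angularHierarchy

end Summit.CriticalPhenomena.Ising3DConformalLimit.Theorems
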